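import Summits.BirchSwinnertonDyer.BirchSwinnertonDyer.Theses.GenusKolyvaginAtTwo
import Summits.BirchSwinnertonDyer.BirchSwinnertonDyer.Theses.ByReductionTypeAtTwo
import Summits.BirchSwinnertonDyer.BirchSwinnertonDyer.Theorems.GenusKolyvaginAtTwoK1NegDepthZeroDefectCurrency
import Summits.BirchSwinnertonDyer.BirchSwinnertonDyer.Theorems.GenusKolyvaginAtTwoK1PosDepthZeroDefectCurrency
import Summits.BirchSwinnertonDyer.BirchSwinnertonDyer.Theorems.GenusKolyvaginAtTwoSupplyKernelsLossless
import HarnessLib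

/-!
# Route `GenusKolyvaginAtTwo` (rev 59): THE LEAF CENSUS AFTER THE ROADS — what the leaf `NonCMAtTwo` rests on, and what the Kolyvagin
# kernels output AT RANK ONE, stated BY NAME against WALL row 1 of route `ByReductionTypeAtTwo`

LEAD `bsd-line-gk2-p1` g27 (cell `bsd-f1-sign2`); `--supports stmt-BirchSwinnertonDyer-23491` (helper; closes nothing).  THEOREMS ONLY (no definition,
no named fact, no `sorry`); standard axioms.  **BSD is NOT proved by this file; no item is closed; WALL row 1 (items stmt-BirchSwinnertonDyer-19095
… 19098 of route `ByReductionTypeAtTwo`), the residual `OffHabitatResidualAtTwo` (stmt-BirchSwinnertonDyer-22139), U₂, K₁±, K₄± stay OPEN.**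
This is the kernel form of director-bsd (644)(a)–(c) (2026-08-30) and critic idea-crit-5 P0 (#533/#535): bookkeeping, not progress.

* §1 **DOMINATION.**  `nonCMAtTwo_of_wallRows_of_offHabitatResidual`: the leaf `Rank1Residual.NonCMAtTwo` (BSD₂ for non-CM curves of analytic rank
  `≤ 1`) follows from the FOUR rank-zero WALL rows of `ByReductionTypeAtTwo` (`GoodOrdinary/Multiplicative/Supersingular/AdditiveRankZeroAtTwo`) and
  the route's OWN declared residual `OffHabitatResidualAtTwo` ALONE — no supply crux, no Kolyvagin item, no U₂, no print item of `closes` is used: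
  a curve of analytic rank `0` is a WALL curve (tetrachotomy of the reduction type at `2`), a curve of analytic rank `1` is off the habitat.
  `nonCMAtTwo_iff_wallRows_and_offHabitatResidual`: conversely the leaf gives back the four rows and the residual (all lossless; the residual
  direction is the LEAD's landed `GenusSupplyNarrow.Lossless.offHabitatResidualAtTwo_of_nonCMAtTwo`).  So, for the
  ledger, **`NonCMAtTwo` ⟺ WALL row 1 ∧ `OffHabitatResidualAtTwo`**: as a leaf-closing device the route is dominated by {WALL row 1, its residual}.
* §2 **WHAT THE ROUTE'S KERNELS OUTPUT AT RANK ONE (the (644)(c) booking, by name).**  With WALL row 1 displayed as hypotheses and the four PRINT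
  items, the LEAD's valuation-ledger currencies give BSD₂ for the RANK-ONE `Sel₂`-minimal twin `Wd = E^(d_K)` of a habitat curve `E`:
  `bsdp_twin_of_wallRows_of_depth_zero_kOneNeg` / `…kOnePos` — on a K₁∓ frame (`#Sel₂(E) = 1`) from the Kolyvagin datum `M₀ = 0` (`y_K ∉ 2E(K)`),
  NO cut, NO Q2; `bsdp_twin_of_wallRows_of_kFourNeg_witness` / `…kFourPos…` — on a K₄∓ cut frame from a deep primitivity witness, mod Q2.
  These are the only places where the route says something about rank-one curves that WALL row 1 does not already say; their inputs
  (`M₀ = 0`, the K₄ witness) are exactly the K-cell items 31525/31468 (negated conclusion) and 31526/31469 (conclusion).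
* §0 `bsdp_rankZero_of_wallRows` (the tetrachotomy, Theorems-side copy of the pen's `bsdp_of_wallRows`) and `wallRows_of_nonCMAtTwo`.

References: [Miller2011LMS] Def. 1.1; [GrossZagier1986] V §2 (2.2); [Milne1972ArithmeticAV] §1 Thm. 1; [SilvermanAEC2009] VII.5, X.4.2.
-/

set_option autoImplicit false
set_option linter.dupNamespace false -- `Summit.<P>.<Sub>` repeats `BirchSwinnertonDyer` (D-0017)

noncomputable section

open scoped Classical

namespace Summit.BirchSwinnertonDyer.BirchSwinnertonDyer.Theorems.GenusExact.Census

open Field IsDedekindDomain WeierstrassCurve NumberField Literature.NumberTheory.EllipticCurves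
  Literature.NumberTheory.EllipticCurves.ModularForms Literature.NumberTheory.GaloisRepresentations
  Summit.BirchSwinnertonDyer.Rank1Residual
  Summit.BirchSwinnertonDyer.BirchSwinnertonDyer.Rank1Residual
  Summit.BirchSwinnertonDyer.BirchSwinnertonDyer.Theorems.GenusExact.ValuationLedger
open Summit.BirchSwinnertonDyer.BirchSwinnertonDyer.Theses.GenusKolyvaginAtTwo
open Summit.BirchSwinnertonDyer.BirchSwinnertonDyer.Theses.ByReductionTypeAtTwo
  (GoodOrdinaryRankZeroAtTwo MultiplicativeRankZeroAtTwo SupersingularRankZeroAtTwo AdditiveRankZeroAtTwo)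

/-! ## §0 WALL row 1 ⟺ the rank-zero half of the leaf -/

/-- **`BSD₂(W)` for every non-CM curve of analytic rank `0` from the four WALL rows of `ByReductionTypeAtTwo`** (items stmt-BirchSwinnertonDyer-19095 …
19098, displayed as hypotheses): tetrachotomy of the reduction type of the globally minimal model at `2` — good with `a₂` odd / even, multiplicative,
additive.  Theorems-side copy of the pen's skeleton lemma `bsdp_of_wallRows`; nothing is proved about the rows. [cite: Miller2011LMS, Def. 1.1] -/
theorem bsdp_rankZero_of_wallRows (hOrd : GoodOrdinaryRankZeroAtTwo) (hMult : MultiplicativeRankZeroAtTwo)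
    (hSS : SupersingularRankZeroAtTwo) (hAdd : AdditiveRankZeroAtTwo)
    (W : WeierstrassCurve ℚ) [W.IsElliptic] [W.IsGloballyMinimal] (hcm : ¬ W.HasCM) (hr0 : W.analyticRank = 0) : BSDp W 2 := by
  by_cases hg : W.HasGoodReductionAtPrime 2
  · by_cases hd : ((2 : ℕ) : ℤ) ∣ W.frobeniusTrace 2
    · exact hSS W hcm hr0 ⟨hg, hd⟩
    · exact hOrd W hcm hr0 ⟨hg, hd⟩
  · by_cases hm : W.HasMultiplicativeReductionAtPrime 2
    · exact hMult W hcm hr0 hm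
    · exact hAdd W hcm hr0 ⟨hg, hm⟩

/-- **The leaf gives back the four WALL rows** (each row is the leaf restricted to analytic rank `0` and one reduction type at `2`; lossless).
[cite: Miller2011LMS, Def. 1.1] -/
theorem wallRows_of_nonCMAtTwo (hleaf : NonCMAtTwo) :
    GoodOrdinaryRankZeroAtTwo ∧ MultiplicativeRankZeroAtTwo ∧ SupersingularRankZeroAtTwo ∧ AdditiveRankZeroAtTwo :=
  ⟨fun W _ _ hcm hr0 _ ↦ hleaf W hcm (by rw [hr0]; exact zero_le_one),
    fun W _ _ hcm hr0 _ ↦ hleaf W hcm (by rw [hr0]; exact zero_le_one),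
    fun W _ _ hcm hr0 _ ↦ hleaf W hcm (by rw [hr0]; exact zero_le_one),
    fun W _ _ hcm hr0 _ ↦ hleaf W hcm (by rw [hr0]; exact zero_le_one)⟩

/-! ## §1 DOMINATION: the leaf from WALL row 1 and the declared residual alone -/

/-- **DOMINATION (census, director-bsd (644) / critic P0 in kernel form).**  The rung-K4 leaf `Rank1Residual.NonCMAtTwo` — the conclusion of this
route's `closes` — follows from the four rank-zero WALL rows of route `ByReductionTypeAtTwo` and this route's own declared residual
`OffHabitatResidualAtTwo` ALONE: analytic rank `0` ⟹ a WALL row (`bsdp_rankZero_of_wallRows`); analytic rank `1` ⟹ the curve is off the habitat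
(the habitat requires analytic rank `0`), so the residual applies.  None of the route's supply / Kolyvagin / descent / U₂ / print items is used.
Nothing is proved about WALL row 1 or the residual (both OPEN, displayed as hypotheses); BSD is NOT proved. [cite: Miller2011LMS, Def. 1.1] -/
theorem nonCMAtTwo_of_wallRows_of_offHabitatResidual (hOrd : GoodOrdinaryRankZeroAtTwo) (hMult : MultiplicativeRankZeroAtTwo)
    (hSS : SupersingularRankZeroAtTwo) (hAdd : AdditiveRankZeroAtTwo) (hR : OffHabitatResidualAtTwo) : NonCMAtTwo := by
  intro W _ _ hcm hr
  rcases Nat.le_one_iff_eq_zero_or_eq_one.mp hr with h0 | h1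
  · exact bsdp_rankZero_of_wallRows hOrd hMult hSS hAdd W hcm h0
  · haveI : NeZero (W.conductorNorm ℤ) := ⟨(W.conductorNorm_pos_holds).ne'⟩
    exact hR W hcm hr (fun hH ↦ absurd (h1.symm.trans hH.1) one_ne_zero)

/-- **`NonCMAtTwo` ⟺ WALL row 1 ∧ `OffHabitatResidualAtTwo`** — for the ledger: as a leaf-closing device route `GenusKolyvaginAtTwo` is EQUIVALENT to
{the four rank-zero rows of `ByReductionTypeAtTwo`, its own declared residual}; its cruxes (supply, Kolyvagin exactness at `2`, exact descent, U₂)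
are MECHANISM relating BSD₂ of twin pairs (§2), not extra leaf content.  BSD is NOT proved. [cite: Miller2011LMS, Def. 1.1] -/
theorem nonCMAtTwo_iff_wallRows_and_offHabitatResidual :
    NonCMAtTwo ↔ (GoodOrdinaryRankZeroAtTwo ∧ MultiplicativeRankZeroAtTwo ∧ SupersingularRankZeroAtTwo ∧ AdditiveRankZeroAtTwo) ∧
      OffHabitatResidualAtTwo :=
  ⟨fun h ↦ ⟨wallRows_of_nonCMAtTwo h, GenusSupplyNarrow.Lossless.offHabitatResidualAtTwo_of_nonCMAtTwo h⟩,
    fun h ↦ nonCMAtTwo_of_wallRows_of_offHabitatResidual h.1.1 h.1.2.1 h.1.2.2.1 h.1.2.2.2 h.2⟩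

/-! ## §2 WHAT THE KERNELS OUTPUT AT RANK ONE: BSD₂ of the `Sel₂`-minimal rank-one twin from WALL row 1 + a Kolyvagin datum at `2` -/

/-- **RANK-ONE OUTPUT ON A K₁⁻ FRAME: WALL row 1 + `M₀ = 0` ⟹ `BSD₂(E^(d_K))`** (mod the four PRINT items; NO cut, NO Q2).  For a habitat curve `E`
(non-CM, `r_an = 0`, `ρ_(E,2^n)` onto, odd Tamagawa, `Δ < 0`, `#Sel₂(E) = 1`), an (H2)-admissible `K`, an odd-Manin frame, `2^(M₀) ∥ P(1)`, and the
globally minimal rank-one twin `Wd ≅ E^(d_K)` with `#Sel₂(Wd) = 2`, `ord₂ C(Wd) ≤ 1`: if the Heegner point is `2`-PRIMITIVE (`M₀ = 0`) then `BSD₂(Wd)`.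
WALL row 1 supplies `BSD₂(E)` (`bsdp_rankZero_of_wallRows`); the LEAD's K₁⁻ currency `bsdp_twin_of_depth_zero_of_bsdp_kOneNeg` does the rest.
`M₀ = 0` is exactly what item K1Neg (stmt-BirchSwinnertonDyer-31525) asserts on this frame.  CONDITIONAL; BSD / U₂ / WALL NOT proved.
[cite: Miller2011LMS, Def. 1.1] [cite: GrossZagier1986, V §2 (2.2)] [cite: Milne1972ArithmeticAV, §1 Thm. 1] [cite: SilvermanAEC2009, Thm. X.4.2] -/
theorem bsdp_twin_of_wallRows_of_depth_zero_kOneNeg (hOrd : GoodOrdinaryRankZeroAtTwo) (hMult : MultiplicativeRankZeroAtTwo)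
    (hSS : SupersingularRankZeroAtTwo) (hAdd : AdditiveRankZeroAtTwo)
    (hGZ : GrossZagierAllLevels) (hGZK : MultPublishedInputsAtTwo) (hL : EntireLFunctionRat) (hMi : MilneAnyModel)
    (W : WeierstrassCurve ℚ) [W.IsElliptic] [W.IsGloballyMinimal] [NeZero (W.conductorNorm ℤ)]
    (hcm : ¬ W.HasCM) (hr0 : W.analyticRank = 0) (hρ : ∀ n : ℕ, 0 < n → W.HasSurjectiveModNGaloisRep ((2 : ℤ) ^ n))
    (hT : Odd W.tamagawaProduct) (hneg : W.Δ < 0) (hSel1 : Nat.card (W.selmerGroup 2) = 1)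
    (K : Type) [Field K] [NumberField K] (hIQ : IsImaginaryQuadratic K) (hodd : Odd (NumberField.discr K))
    (h3 : NumberField.discr K ≠ -3) (hHe : SatisfiesHeegnerHypothesis (W.conductorNorm ℤ) K)
    (hsq1 : ¬ IsSquare ((NumberField.discr K : ℚ) * -|W.Δ|)) (hsq2 : ¬ IsSquare ((NumberField.discr K : ℚ) * (-(2 * |W.Δ|))))
    (Dt : ModularParametrizationData W (W.conductorNorm ℤ))
    (hopt : ∀ z ∈ Dt.L.lattice, ∃ w ∈ periodLattice Dt.f, z = (Dt.c : ℂ) * w) (hc : Odd Dt.c)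
    (β : ℤ) (ι : K →+* ℂ) (d₁ : KolyvaginHeegnerData Dt β ι 1) (hy : ¬ IsOfFinAddOrder d₁.derivedPoint)
    (M₀ : ℕ) (hdiv : ∃ Q : (W.baseChange (ringClassField K ι 1)).toAffine.Point, ((2 ^ M₀ : ℕ) : ℤ) • Q = d₁.derivedPoint)
    (hndiv : ¬ ∃ Q : (W.baseChange (ringClassField K ι 1)).toAffine.Point, ((2 ^ (M₀ + 1) : ℕ) : ℤ) • Q = d₁.derivedPoint)
    (Wd : WeierstrassCurve ℚ) [Wd.IsElliptic] [Wd.IsGloballyMinimal]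
    (hWd : ∃ C : VariableChange ℚ, C • W.quadraticTwist (NumberField.discr K : ℚ) = Wd)
    (hrd : Wd.analyticRank = 1) (hSel : Nat.card (Wd.selmerGroup 2) = 2) (hDEF : padicValNat 2 Wd.tamagawaProduct ≤ 1)
    (hM₀ : M₀ = 0) : BSDp Wd 2 :=
  bsdp_twin_of_depth_zero_of_bsdp_kOneNeg hGZ hGZK hL hMi W hcm hr0 hρ hT hneg hSel1 K hIQ hodd h3 hHe hsq1 hsq2 Dt hopt hc β ι d₁ hy M₀ hdiv
    hndiv Wd hWd hrd hSel hDEF (bsdp_rankZero_of_wallRows hOrd hMult hSS hAdd W hcm hr0) hM₀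

/-- **RANK-ONE OUTPUT ON A K₁⁺ FRAME: WALL row 1 + `M₀ = 0` ⟹ `BSD₂(E^(d_K))`** (mod PRINT; NO cut, NO Q2) — the `Δ > 0` twin of
`bsdp_twin_of_wallRows_of_depth_zero_kOneNeg` (shallow twin: `ord₂ C(Wd) = 0`); `M₀ = 0` is what item K1Pos (stmt-BirchSwinnertonDyer-31468) asserts.
CONDITIONAL; BSD / U₂ / WALL NOT proved. [cite: Miller2011LMS, Def. 1.1] [cite: GrossZagier1986, V §2 (2.2)] [cite: Milne1972ArithmeticAV, §1 Thm. 1] -/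
theorem bsdp_twin_of_wallRows_of_depth_zero_kOnePos (hOrd : GoodOrdinaryRankZeroAtTwo) (hMult : MultiplicativeRankZeroAtTwo)
    (hSS : SupersingularRankZeroAtTwo) (hAdd : AdditiveRankZeroAtTwo)
    (hGZ : GrossZagierAllLevels) (hGZK : MultPublishedInputsAtTwo) (hL : EntireLFunctionRat) (hMi : MilneAnyModel)
    (W : WeierstrassCurve ℚ) [W.IsElliptic] [W.IsGloballyMinimal] [NeZero (W.conductorNorm ℤ)]
    (hcm : ¬ W.HasCM) (hr0 : W.analyticRank = 0) (hρ : ∀ n : ℕ, 0 < n → W.HasSurjectiveModNGaloisRep ((2 : ℤ) ^ n))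
    (hT : Odd W.tamagawaProduct) (hpos : 0 < W.Δ) (hSel1 : Nat.card (W.selmerGroup 2) = 1)
    (K : Type) [Field K] [NumberField K] (hIQ : IsImaginaryQuadratic K) (hodd : Odd (NumberField.discr K))
    (h3 : NumberField.discr K ≠ -3) (hHe : SatisfiesHeegnerHypothesis (W.conductorNorm ℤ) K)
    (hsq1 : ¬ IsSquare ((NumberField.discr K : ℚ) * -|W.Δ|)) (hsq2 : ¬ IsSquare ((NumberField.discr K : ℚ) * (-(2 * |W.Δ|))))
    (Dt : ModularParametrizationData W (W.conductorNorm ℤ))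
    (hopt : ∀ z ∈ Dt.L.lattice, ∃ w ∈ periodLattice Dt.f, z = (Dt.c : ℂ) * w) (hc : Odd Dt.c)
    (β : ℤ) (ι : K →+* ℂ) (d₁ : KolyvaginHeegnerData Dt β ι 1) (hy : ¬ IsOfFinAddOrder d₁.derivedPoint)
    (M₀ : ℕ) (hdiv : ∃ Q : (W.baseChange (ringClassField K ι 1)).toAffine.Point, ((2 ^ M₀ : ℕ) : ℤ) • Q = d₁.derivedPoint)
    (hndiv : ¬ ∃ Q : (W.baseChange (ringClassField K ι 1)).toAffine.Point, ((2 ^ (M₀ + 1) : ℕ) : ℤ) • Q = d₁.derivedPoint)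
    (Wd : WeierstrassCurve ℚ) [Wd.IsElliptic] [Wd.IsGloballyMinimal]
    (hWd : ∃ C : VariableChange ℚ, C • W.quadraticTwist (NumberField.discr K : ℚ) = Wd)
    (hrd : Wd.analyticRank = 1) (hSel : Nat.card (Wd.selmerGroup 2) = 2) (hDEF : padicValNat 2 Wd.tamagawaProduct = 0)
    (hM₀ : M₀ = 0) : BSDp Wd 2 :=
  bsdp_twin_of_depth_zero_of_bsdp_kOnePos hGZ hGZK hL hMi W hcm hr0 hρ hT hpos hSel1 K hIQ hodd h3 hHe hsq1 hsq2 Dt hopt hc β ι d₁ hy M₀ hdiv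
    hndiv Wd hWd hrd hSel hDEF (bsdp_rankZero_of_wallRows hOrd hMult hSS hAdd W hcm hr0) hM₀

/-- **RANK-ONE OUTPUT ON A K₄⁻ CUT FRAME: WALL row 1 + a deep primitivity witness ⟹ `BSD₂(E^(d_K))`** (mod Q2 `KolyvaginRelationAtTwo` + PRINT).
For a habitat curve `E` with `Δ < 0`, `#Sel₂(E) = 4`, an odd multiplicative place `v` (the cut), a PRIME `2`-split (H2)-admissible `K = ℚ(√-ℓ₀)`, an
odd-Manin frame with `2^(M₀) ∥ P(1)`, `M₀ ≥ 1`, and the rank-one twin `Wd` (`#Sel₂ = 2`, `ord₂ C ≤ 1`): a square-free `FrobEqFrobInfty` witness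
`P(n) ∉ 2E(K[n])` gives `BSD₂(Wd)`.  WALL row 1 supplies `BSD₂(E)`; the LEAD's K₄⁻ currency `bsdp_twin_of_kFourNeg_witness_of_bsdp` does the rest.
The witness is exactly the conclusion of item K4Neg (stmt-BirchSwinnertonDyer-31526) at this frame.  CONDITIONAL; BSD / U₂ / WALL NOT proved.
[cite: Miller2011LMS, Def. 1.1] [cite: GrossZagier1986, V §2 (2.2)] [cite: Milne1972ArithmeticAV, §1 Thm. 1] [cite: McCallumLMS1991, §5 Thm. 5.4] -/
theorem bsdp_twin_of_wallRows_of_kFourNeg_witness (hOrd : GoodOrdinaryRankZeroAtTwo) (hMult : MultiplicativeRankZeroAtTwo)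
    (hSS : SupersingularRankZeroAtTwo) (hAdd : AdditiveRankZeroAtTwo)
    (hGZ : GrossZagierAllLevels) (hGZK : MultPublishedInputsAtTwo) (hL : EntireLFunctionRat) (hMi : MilneAnyModel)
    (hQ2 : KolyvaginRelationAtTwo)
    (W : WeierstrassCurve ℚ) [W.IsElliptic] [W.IsGloballyMinimal] [NeZero (W.conductorNorm ℤ)] (hcm : ¬ W.HasCM)
    (hr0 : W.analyticRank = 0) (hρ : ∀ n : ℕ, 0 < n → W.HasSurjectiveModNGaloisRep ((2 : ℤ) ^ n)) (hT : Odd W.tamagawaProduct)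
    (hneg : W.Δ < 0) (h4 : Nat.card (W.selmerGroup 2) = 4)
    (K : Type) [Field K] [NumberField K] (hIQ : IsImaginaryQuadratic K) (hodd : Odd (NumberField.discr K))
    (h3 : NumberField.discr K ≠ -3) (hHe : SatisfiesHeegnerHypothesis (W.conductorNorm ℤ) K)
    (hsq1 : ¬ IsSquare ((NumberField.discr K : ℚ) * -|W.Δ|)) (hsq2 : ¬ IsSquare ((NumberField.discr K : ℚ) * (-(2 * |W.Δ|))))
    (ℓ₀ : ℕ) (hℓ₀ : ℓ₀.Prime) (hdK : NumberField.discr K = -(ℓ₀ : ℤ))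
    (h2K : ((Ideal.span {(2 : ℤ)}).primesOver (𝓞 K)).ncard = 2)
    (Dt : ModularParametrizationData W (W.conductorNorm ℤ))
    (hopt : ∀ z ∈ Dt.L.lattice, ∃ w ∈ periodLattice Dt.f, z = (Dt.c : ℂ) * w) (hc : Odd Dt.c)
    (β : ℤ) (ι : K →+* ℂ) (d₁ : KolyvaginHeegnerData Dt β ι 1) (hy : ¬ IsOfFinAddOrder d₁.derivedPoint) (M₀ : ℕ)
    (hdiv : ∃ Q : (W.baseChange (ringClassField K ι 1)).toAffine.Point, ((2 ^ M₀ : ℕ) : ℤ) • Q = d₁.derivedPoint)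
    (hndiv : ¬ ∃ Q : (W.baseChange (ringClassField K ι 1)).toAffine.Point, ((2 ^ (M₀ + 1) : ℕ) : ℤ) • Q = d₁.derivedPoint)
    (hM₀ : 1 ≤ M₀) (Wd : WeierstrassCurve ℚ) [Wd.IsElliptic] [Wd.IsGloballyMinimal]
    (hWd : ∃ C : VariableChange ℚ, C • W.quadraticTwist (NumberField.discr K : ℚ) = Wd) (hrd : Wd.analyticRank = 1)
    (hSel : Nat.card (Wd.selmerGroup 2) = 2) (hDEF : padicValNat 2 Wd.tamagawaProduct ≤ 1)
    (v : HeightOneSpectrum (𝓞 ℚ)) (h2v : ((2 : ℕ) : 𝓞 ℚ) ∉ v.asIdeal) (hNv : ((W.conductorNorm ℤ : ℕ) : 𝓞 ℚ) ∈ v.asIdeal)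
    (hmult : W.HasMultiplicativeReductionAt v)
    (hK4 : ∃ (n : ℕ) (d : KolyvaginHeegnerData Dt β ι n), Squarefree n ∧
      (∀ ℓ ∈ n.primeFactors, Zhang2014.IsKolyvaginPrime (W.conductorNorm ℤ) W K 2 ℓ ∧ 2 ≤ Zhang2014.kolyvaginIndex W 2 ℓ ∧
        FrobEqFrobInfty W K 2 ℓ) ∧
      ¬ ∃ Q : (W.baseChange (ringClassField K ι n)).toAffine.Point, (2 : ℤ) • Q = d.derivedPoint) :
    BSDp Wd 2 :=
  bsdp_twin_of_kFourNeg_witness_of_bsdp hGZ hGZK hL hMi hQ2 W hcm hr0 hρ hT hneg h4 K hIQ hodd h3 hHe hsq1 hsq2 ℓ₀ hℓ₀ hdK h2K Dt hopt hc β ι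
    d₁ hy M₀ hdiv hndiv hM₀ Wd hWd hrd hSel hDEF v h2v hNv hmult (bsdp_rankZero_of_wallRows hOrd hMult hSS hAdd W hcm hr0) hK4

/-- **RANK-ONE OUTPUT ON A K₄⁺ CUT FRAME: WALL row 1 + a deep primitivity witness ⟹ `BSD₂(E^(d_K))`** (mod Q2 + PRINT) — the `Δ > 0` twin of
`bsdp_twin_of_wallRows_of_kFourNeg_witness` (real-narrow `#Sel₂(E) = 4` cell, shallow twin `ord₂ C(Wd) = 0`, transposition-deep witness); the
witness is the conclusion of item K4Pos (stmt-BirchSwinnertonDyer-31469) at this frame.  CONDITIONAL; BSD / U₂ / WALL NOT proved.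
[cite: Miller2011LMS, Def. 1.1] [cite: GrossZagier1986, V §2 (2.2)] [cite: Milne1972ArithmeticAV, §1 Thm. 1] [cite: McCallumLMS1991, §5 Thm. 5.4] -/
theorem bsdp_twin_of_wallRows_of_kFourPos_witness (hOrd : GoodOrdinaryRankZeroAtTwo) (hMult : MultiplicativeRankZeroAtTwo)
    (hSS : SupersingularRankZeroAtTwo) (hAdd : AdditiveRankZeroAtTwo)
    (hGZ : GrossZagierAllLevels) (hGZK : MultPublishedInputsAtTwo) (hL : EntireLFunctionRat) (hMi : MilneAnyModel)
    (hQ2 : KolyvaginRelationAtTwo)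
    (W : WeierstrassCurve ℚ) [W.IsElliptic] [W.IsGloballyMinimal] [NeZero (W.conductorNorm ℤ)] (hcm : ¬ W.HasCM)
    (hr0 : W.analyticRank = 0) (hρ : ∀ n : ℕ, 0 < n → W.HasSurjectiveModNGaloisRep ((2 : ℤ) ^ n)) (hT : Odd W.tamagawaProduct)
    (hpos : 0 < W.Δ)
    (h4 : Nat.card (W.selmerGroup 2) = 4 ∧ ∃ c ∈ (W.kummerSelmerStructure ((2 : ℕ) : ℤ)).selmerGroup,
      galoisCohomology.localization (W.torsionGaloisModule ((2 : ℕ) : ℤ)) (Sum.inl Rat.infinitePlace) 1 c ≠ 0)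
    (K : Type) [Field K] [NumberField K] (hIQ : IsImaginaryQuadratic K) (hodd : Odd (NumberField.discr K))
    (h3 : NumberField.discr K ≠ -3) (hHe : SatisfiesHeegnerHypothesis (W.conductorNorm ℤ) K)
    (hsq1 : ¬ IsSquare ((NumberField.discr K : ℚ) * -|W.Δ|)) (hsq2 : ¬ IsSquare ((NumberField.discr K : ℚ) * (-(2 * |W.Δ|))))
    (ℓ₀ : ℕ) (hℓ₀ : ℓ₀.Prime) (hdK : NumberField.discr K = -(ℓ₀ : ℤ))
    (h2K : ((Ideal.span {(2 : ℤ)}).primesOver (𝓞 K)).ncard = 2)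
    (Dt : ModularParametrizationData W (W.conductorNorm ℤ)) (hc : Odd Dt.c)
    (β : ℤ) (ι : K →+* ℂ) (d₁ : KolyvaginHeegnerData Dt β ι 1) (hy : ¬ IsOfFinAddOrder d₁.derivedPoint) (M₀ : ℕ)
    (hdiv : ∃ Q : (W.baseChange (ringClassField K ι 1)).toAffine.Point, ((2 ^ M₀ : ℕ) : ℤ) • Q = d₁.derivedPoint)
    (hndiv : ¬ ∃ Q : (W.baseChange (ringClassField K ι 1)).toAffine.Point, ((2 ^ (M₀ + 1) : ℕ) : ℤ) • Q = d₁.derivedPoint)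
    (hM₀ : 1 ≤ M₀) (Wd : WeierstrassCurve ℚ) [Wd.IsElliptic] [Wd.IsGloballyMinimal]
    (hWd : ∃ C : VariableChange ℚ, C • W.quadraticTwist (NumberField.discr K : ℚ) = Wd) (hrd : Wd.analyticRank = 1)
    (hSel : Nat.card (Wd.selmerGroup 2) = 2) (hDEF : padicValNat 2 Wd.tamagawaProduct = 0)
    (v : HeightOneSpectrum (𝓞 ℚ)) (h2v : ((2 : ℕ) : 𝓞 ℚ) ∉ v.asIdeal) (hNv : ((W.conductorNorm ℤ : ℕ) : 𝓞 ℚ) ∈ v.asIdeal)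
    (hmult : W.HasMultiplicativeReductionAt v)
    (hK4 : ∃ (n : ℕ) (d : KolyvaginHeegnerData Dt β ι n), Squarefree n ∧
      (∀ ℓ ∈ n.primeFactors, Zhang2014.IsKolyvaginPrime (W.conductorNorm ℤ) W K 2 ℓ ∧ 2 ≤ Zhang2014.kolyvaginIndex W 2 ℓ ∧
        ∃ (v : HeightOneSpectrum (𝓞 ℚ)) (𝔓 : Ideal (absIntegers (𝓞 ℚ) ℚ)) (h : absoluteGaloisGroup ℚ),
          ((ℓ : ℕ) : 𝓞 ℚ) ∈ v.asIdeal ∧ 𝔓 ∈ v.primesAbove ∧ IsArithFrobAt (𝓞 ℚ) h 𝔓 ∧ ∃ u : W.geomTorsion ((2 : ℕ) : ℤ), h • u ≠ u) ∧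
      ¬ ∃ Q : (W.baseChange (ringClassField K ι n)).toAffine.Point, (2 : ℤ) • Q = d.derivedPoint) :
    BSDp Wd 2 :=
  bsdp_twin_of_kFourPos_witness_of_bsdp hGZ hGZK hL hMi hQ2 W hcm hr0 hρ hT hpos h4 K hIQ hodd h3 hHe hsq1 hsq2 ℓ₀ hℓ₀ hdK h2K Dt hc β ι d₁ hy
    M₀ hdiv hndiv hM₀ Wd hWd hrd hSel hDEF v h2v hNv hmult (bsdp_rankZero_of_wallRows hOrd hMult hSS hAdd W hcm hr0) hK4

end Summit.BirchSwinnertonDyer.BirchSwinnertonDyer.Theorems.GenusExact.Census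

end
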